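import Summits.ResolutionOfSingularities.ResolutionOfSingularities.Theorems.FrobeniusClosingPatchingRelPerfectDepthFlagCascadeSeq
import HarnessLib

/-!
# Crux `PatchingRelPerfect` (stmt-ResolutionOfSingularities-16161), chain W5.2 — T6-E1b residual: `CompanionDescent` HOLDS
# modulo [CoP1] Prop. 4.4 (res-L1-w52-idea-1's target C6-A, Sketch v9 §5; proof res-D-pv-054)

[OURS · L1 W5.2] NOT statements of the manuscript under review (Hironaka 2017); AI-written, weaker than expert review.
F-33 `CossartPiltant2008_prop44` is NOT an admissible premise of this chain: it is the explicit, labelled CONDITIONAL hypothesis of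
`companionDescent_of_prop44`, nothing else.

`companion_transport`: along a permissible sequence of [CoP1] Prop. 4.4 (`IsPermissibleSeq π O m O'`) for the COMPANION
`O = J^{N-μ} ⊔ D^μ`, `m = μ(N-μ)`, of stage data `(M, D, J)` with the cascade invariant `INV(μ)`: every centre point lies in
`Sing(O_μ)`, so `ord J = μ` exactly (`idealOrder_eq_of_mem_support_companion`) and `ord D ≥ N - μ`; hence the step is a
Σ-permissible step for `(D·J, N)` (`natCast_le_idealOrder_mul_of_mem_support_companion`, `controlledTransform_mul`), the stage
data transport as in the tree's `IsPermissibleSeq.transport` (`IsRegularCentreBlowupSeq.cons` via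
`not_isLocallyPrincipalAt_mul_of_forall_one_lt_coheight`, `pow_mul_controlledTransform_eq_of_forall_idealOrder_eq`,
`isEffectiveCartier_controlledTransform_of_le_pow`, `one_lt_coheight_of_mem_support_controlledTransform`), `INV(μ)` by Giraud's
non-increase on the exceptional divisor (`idealOrder_controlledTransform_le_of_mem`: `ord J' ≤ μ < μ'`) and invariance off it
(`idealOrder_controlledTransform_of_not_mem`), and the companion equation by `transform_companion` (BGMW Lemma 3.7.1 «moreover»).
`companionDescent_of_prop44`: if `Sing(O_μ) = ∅` nothing to do; else Prop. 4.4 applies to `(O_μ, μ(N-μ))` on the stage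
(`codim V(O_μ) ≥ 2` as `V(O_μ) ⊆ V(J)`; `idealOrder_companion_le`/`…_eq_of_mem_support`), transport, and at the end
`ord O' < μ(N-μ)` everywhere is `Sing(O'_μ) = ∅`, i.e. `INV(μ-1)`.

## References
* V. Cossart, O. Piltant, J. Algebra 320 (2008), Prop. 4.4 and proof of Prop. 4.2. [CossartPiltant2008]
* E. Bierstone, D. Grigoriev, P. Milman, J. Włodarczyk (2011), §3.7, Lemma 3.7.1. [BierstoneGrigorievMilmanWlodarczyk2011]
* J. Giraud, *Étude locale des singularités* (1972) / Kollár 2007, 3.67 (order does not increase under permissible blow-up). [Kollar2007]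
-/

-- `Summit.<Summit>.<Sub>.Theorems` with `Sub = Summit` (single-conjunct summit, D-0017)
set_option linter.dupNamespace false

noncomputable section

open CategoryTheory CategoryTheory.Limits AlgebraicGeometry TopologicalSpace IsLocalRing
open Literature.AlgebraicGeometry.Resolution

namespace Summit.ResolutionOfSingularities.ResolutionOfSingularities.Theorems

universe u

namespace DepthCascade

variable {X : Scheme.{u}}

/-! ## `CompanionDescent` from [CoP1] Prop. 4.4 -/

section Descent

open Scheme.IdealSheafData

/-- The support of the companion lies in `V(J)` (for `μ < N`). [folklore] -/
theorem support_companion_subset (B : List X.IdealSheafData) (D J : X.IdealSheafData) {N μ : ℕ}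
    (hμ : 1 ≤ μ) (hμN : μ < N) {x : X} [IsRegularLocalRing (X.presheaf.stalk x)]
    (hx : x ∈ (companion B D J N μ).support) : x ∈ J.support := by
  obtain ⟨hJ, -⟩ := (mem_support_companion_iff B D J hμ hμN).mp hx
  exact (one_le_idealOrder_iff J x).mp (le_trans (by exact_mod_cast hμ) hJ)

/-- **ONE COMPANION STEP is a Σ-permissible step with all bookkeeping** — transport of the stage data,
the cascade invariant `INV(μ)` and the companion equation along a permissible sequence of [CoP1] Prop. 4.4
for the companion `O_μ` (pattern `IsPermissibleSeq.transport`). [cite: CossartPiltant2008, Prop. 4.4]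
[cite: BierstoneGrigorievMilmanWlodarczyk2011, Lemma 3.7.1] -/
theorem companion_transport {S : Scheme.{u}} [IsIntegral S] [IsNoetherian S] (hS : Scheme.IsRegular S)
    (I : S.IdealSheafData) {N μ : ℕ} (hμ : 1 ≤ μ) (hμN : μ < N) :
    ∀ {X' X : Scheme.{u}} {π : X' ⟶ X} {O : X.IdealSheafData} {m : ℕ} {O' : X'.IdealSheafData},
      IsPermissibleSeq π O m O' →
      ∀ (ρ : X ⟶ S) (M D J : X.IdealSheafData), IsIntegral X → IsNoetherian X →
        StageData S I X ρ M D J → NoStratumAbove D J N μ →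
        O = J ^ (N - μ) ⊔ D ^ μ → m = μ * (N - μ) →
        IsIntegral X' ∧ IsNoetherian X' ∧
          ∃ (M' D' J' : X'.IdealSheafData), IsSingPermissibleSeq π (D * J) N (D' * J') ∧
            StageData S I X' (π ≫ ρ) M' D' J' ∧ NoStratumAbove D' J' N μ ∧ O' = J' ^ (N - μ) ⊔ D' ^ μ := by
  intro X' X π O m O' h
  induction h with
  | nil O m =>
    intro ρ M D J hint hnoeth hst hinv hO hm
    refine ⟨hint, hnoeth, M, D, J, IsSingPermissibleSeq.nil _ _, ?_, hinv, hO⟩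
    rwa [Category.id_comp]
  | @cons X'' X' X τ π O m O' Y hπ hYint hYreg hY hτ ih =>
    intro ρ M D J hint hnoeth hst hinv hO hm
    obtain ⟨hint', hnoeth', M', D', J', hseq', hst', hinv', hO'⟩ := ih ρ M D J hint hnoeth hst hinv hO hm
    haveI := hint'
    haveI := hnoeth'
    obtain ⟨hρ', hM', hD', hfac', hJ'coh⟩ := hst'
    have hreg' : Scheme.IsRegular X' := hρ'.isRegular hS
    have hJ'0 : J' ≠ ⊥ := ne_bot_of_forall_one_lt_coheight hJ'coh
    -- the centre lies in `Sing(O_μ)`: `ord J' = μ` and `ord D' ≥ N - μ` along `Y`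
    have hYsupp : ∀ y ∈ (Y : Set X'), y ∈ (companion ([] : List X'.IdealSheafData) D' J' N μ).support := by
      intro y hy
      show ((μ * (N - μ) : ℕ) : ℕ∞) ≤ idealOrder (J' ^ (N - μ) ⊔ D' ^ μ) y
      rw [← hO', hY y hy, hm]
    have hYJ : ∀ y ∈ (Y : Set X'), idealOrder J' y = μ := fun y hy => by
      haveI := hreg' y
      exact idealOrder_eq_of_mem_support_companion [] hμ hμN hinv' (hYsupp y hy)
    have hYD : ∀ y ∈ (Y : Set X'), ((N - μ : ℕ) : ℕ∞) ≤ idealOrder D' y := fun y hy => by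
      haveI := hreg' y
      exact ((mem_support_companion_iff [] D' J' hμ hμN).mp (hYsupp y hy)).2
    -- the new scheme is integral and Noetherian
    haveI : IsIntegral X'' := hτ.isIntegral (vanishingIdeal_ne_bot_of_forall_idealOrder_eq hJ'0 hμ hYJ)
    haveI : IsNoetherian X'' := by
      haveI : IsProper τ := hτ.isProper
      haveI := LocallyOfFiniteType.isLocallyNoetherian τ
      haveI := QuasiCompact.compactSpace_of_compactSpace τ
      exact {}
    -- divisibilities along the centre
    have hJle : J' ≤ vanishingIdeal Y ^ μ := le_vanishingIdeal_pow_of_forall_idealOrder_eq hreg' hYreg hYJ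
    have hDle : D' ≤ vanishingIdeal Y ^ (N - μ) :=
      le_pow_of_isRegular_subscheme_of_forall_le_idealOrder_of_isRegular hreg' hYreg fun y hy => hYD y (by
        rwa [← Scheme.IdealSheafData.coe_support_vanishingIdeal Y])
    have hE : IsEffectiveCartier ((vanishingIdeal Y).comap τ) := hτ.isEffectiveCartier
    set J'' := controlledTransform τ (vanishingIdeal Y) J' μ with hJ''
    set D'' := controlledTransform τ (vanishingIdeal Y) D' (N - μ) with hD''
    refine ⟨inferInstance, inferInstance, M'.comap τ * (vanishingIdeal Y).comap τ ^ μ, D'', J'', ?_, ?_, ?_, ?_⟩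
    · -- the Σ-permissible step for `(D·J, N)`
      have hstep := IsSingPermissibleSeq.cons τ π (D * J) N (D' * J') Y hseq' hYint hYreg (fun y hy => by
        haveI := hreg' y
        exact natCast_le_idealOrder_mul_of_mem_support_companion [] D' J' hμN.le hμ hμN (hYsupp y hy)) hτ
      have hmul : controlledTransform τ (vanishingIdeal Y) (D' * J') N = D'' * J'' := by
        have h := controlledTransform_mul hE (comap_le_comap_pow_of_le_pow hDle τ) (comap_le_comap_pow_of_le_pow hJle τ)
        rwa [Nat.sub_add_cancel hμN.le] at h
      rwa [hmul] at hstep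
    · -- the stage data
      refine ⟨?_, (hM'.comap_of_isBlowup hτ).mul (hτ.isEffectiveCartier.pow μ),
        hτ.isEffectiveCartier_controlledTransform_of_le_pow hD' hDle, ?_, fun x hx =>
        hτ.one_lt_coheight_of_mem_support_controlledTransform hreg' hYreg hYJ hJ'coh hx⟩
      · rw [Category.assoc]
        refine IsRegularCentreBlowupSeq.cons τ (π ≫ ρ) I Y hρ' hYint hYreg (fun y hy => ?_) hτ
        rw [hfac']
        refine not_isLocallyPrincipalAt_mul_of_forall_one_lt_coheight hM' hJ'0 hJ'coh ?_
        refine (one_le_idealOrder_iff J' y).mp ?_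
        rw [hYJ y hy]
        exact_mod_cast hμ
      · rw [Category.assoc, Scheme.IdealSheafData.comap_comp, hfac', comap_mul,
          ← hτ.pow_mul_controlledTransform_eq_of_forall_idealOrder_eq hreg' hYreg hYJ, mul_assoc]
    · -- the invariant `INV(μ)` upstairs
      refine ⟨fun x' => ?_, fun x' μ' h1 h2 h3 => ?_⟩
      · by_cases hx : τ x' ∈ (Y : Set X')
        · exact lt_of_le_of_lt (hτ.idealOrder_controlledTransform_le_of_mem hreg' hYreg hYJ hx)
            (by exact_mod_cast hμN)
        · have hxC : τ x' ∉ ((vanishingIdeal Y).support : Set X') := by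
            rwa [Scheme.IdealSheafData.coe_support_vanishingIdeal]
          rw [hJ'', hτ.idealOrder_controlledTransform_of_not_mem J' μ hxC]
          exact hinv'.1 _
      · by_cases hx : τ x' ∈ (Y : Set X')
        · exfalso
          have hle := hτ.idealOrder_controlledTransform_le_of_mem hreg' hYreg hYJ hx
          have : (μ' : ℕ∞) ≤ μ := h3.trans hle
          exact absurd (by exact_mod_cast this : μ' ≤ μ) (not_le.mpr h1)
        · have hxC : τ x' ∉ ((vanishingIdeal Y).support : Set X') := by
            rwa [Scheme.IdealSheafData.coe_support_vanishingIdeal]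
          rw [hD'', hτ.idealOrder_controlledTransform_of_not_mem D' (N - μ) hxC]
          rw [hJ'', hτ.idealOrder_controlledTransform_of_not_mem J' μ hxC] at h3
          exact hinv'.2 _ μ' h1 h2 h3
    · -- the companion equation upstairs (BGMW 3.7.1 «moreover»)
      have h := transform_companion hE ([] : List X'.IdealSheafData) D' J' (N := N) (μ := μ)
        (comap_le_comap_pow_of_le_pow hJle τ) (comap_le_comap_pow_of_le_pow hDle τ)
      have h' := congrArg MarkedIdeal.ideal h
      simp only [companion, MarkedIdeal.transform_ideal, MarkedIdeal.sum_ideal, MarkedIdeal.transform_mult,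
        MarkedIdeal.sum_mult] at h'
      rw [hO', hm]
      exact h'

/-- [OURS · L1 W5.2] **`CompanionDescent` HOLDS modulo [CoP1] Prop. 4.4** (F-33 = tree `CossartPiltant2008_prop44`,
an explicit CONDITIONAL binder — NOT an admissible premise of the chain): res-L1-w52-idea-1's §5 proof sketch, kernel-checked.
If `Sing(O_μ) = ∅` the empty sequence already has `INV(μ-1)`; otherwise Prop. 4.4 applies to the companion `O_μ` on the
stage (`codim V(O_μ) ≥ 2` as `V(O_μ) ⊆ V(J)`; `ord O_μ ≤ μ(N-μ)` everywhere by `INV(μ)`, `= μ(N-μ)` on its support) and its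
permissible sequence is transported by `companion_transport`; at the end `ord O' < μ(N-μ)` everywhere is `Sing(O'_μ) = ∅`,
i.e. `INV(μ-1)`. [cite: CossartPiltant2008, Prop. 4.4] [cite: BierstoneGrigorievMilmanWlodarczyk2011, Lemma 3.7.1] -/
theorem companionDescent_of_prop44 (h44 : CossartPiltant2008_prop44.{u}) : CompanionDescent.{u} := by
  intro S _ _ hreg hexc hdim I hI X ρ _ _ M D J N μ hst hμ hμN hinv
  have hregX : Scheme.IsRegular X := hst.1.isRegular hreg
  set O : X.IdealSheafData := J ^ (N - μ) ⊔ D ^ μ with hOdef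
  set m : ℕ := μ * (N - μ) with hmdef
  by_cases hempty : ∀ x, idealOrder O x < (m : ℕ∞)
  · -- `Sing(O_μ) = ∅`: nothing to do
    refine ⟨X, inferInstance, inferInstance, 𝟙 X, M, D, J, IsSingPermissibleSeq.nil _ _, ?_, hinv.1, fun x μ' h1 h2 h3 => ?_⟩
    · rwa [Category.id_comp]
    · haveI := hregX x
      rcases Nat.lt_or_ge μ μ' with hlt | hge
      · exact hinv.2 x μ' hlt h2 h3
      · -- `μ' = μ`: if `ord D ≥ N - μ` then `x ∈ Sing(O_μ)`, contradiction
        have hμ' : μ' = μ := by omega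
        subst hμ'
        by_contra hD
        rw [not_lt] at hD
        have hx : x ∈ (companion ([] : List X.IdealSheafData) D J N μ').support :=
          (mem_support_companion_iff [] D J hμ hμN).mpr ⟨h3, hD⟩
        have := idealOrder_companion_eq_of_mem_support [] hμ hμN hinv hx
        have hlt := hempty x
        rw [show (companion ([] : List X.IdealSheafData) D J N μ').ideal = O from rfl] at this
        rw [this] at hlt
        exact lt_irrefl _ hlt
  · -- Prop. 4.4 for the companion `(O_μ, μ(N-μ))` on the stage
    push Not at hempty
    obtain ⟨x₀, hx₀⟩ := hempty
    haveI := hregX x₀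
    have hm1 : 1 ≤ m := Nat.one_le_iff_ne_zero.mpr (Nat.mul_ne_zero (by omega) (by omega))
    have hx₀' : x₀ ∈ (companion ([] : List X.IdealSheafData) D J N μ).support := hx₀
    have hOle : ∀ x, idealOrder O x ≤ (m : ℕ∞) := fun x => by
      haveI := hregX x; exact idealOrder_companion_le [] hμ hμN hinv x
    have hOeq : ∃ x, idealOrder O x = (m : ℕ∞) := ⟨x₀, idealOrder_companion_eq_of_mem_support [] hμ hμN hinv hx₀'⟩
    have hOcoh : ∀ x ∈ O.support, 1 < Order.coheight x := by
      intro x hx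
      haveI := hregX x
      refine hst.2.2.2.2 x ?_
      -- `x ∈ V(O) ⊆ V(J^{N-μ}) = V(J)`
      have h1 : (1 : ℕ∞) ≤ idealOrder O x := (one_le_idealOrder_iff O x).mpr hx
      have h2 : (1 : ℕ∞) ≤ idealOrder (J ^ (N - μ)) x := h1.trans (idealOrder_anti' le_sup_left x)
      obtain ⟨a, ha⟩ := ENat.ne_top_iff_exists.mp (hinv.1 x).ne_top
      rw [idealOrder_pow_eq J ha.symm (N - μ)] at h2
      have ha1 : 1 ≤ a := by
        by_contra h0
        have h00 : a = 0 := by omega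
        subst h00
        rw [Nat.mul_zero] at h2
        exact absurd h2 (by norm_num)
      exact (one_le_idealOrder_iff J x).mp (by rw [← ha]; exact_mod_cast ha1)
    obtain ⟨X', π, O', hπ, hO'⟩ := h44 S hreg hexc hdim I hI X ρ hst.1 O m hm1 hOcoh hOle hOeq
    obtain ⟨hint', hnoeth', M', D', J', hseq, hst', hinv', hO'eq⟩ :=
      companion_transport hreg I hμ hμN hπ ρ M D J inferInstance inferInstance hst hinv rfl rfl
    haveI := hint'
    haveI := hnoeth'
    have hregX' : Scheme.IsRegular X' := hst'.1.isRegular hreg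
    refine ⟨X', hint', hnoeth', π, M', D', J', hseq, hst', hinv'.1, fun x μ' h1 h2 h3 => ?_⟩
    haveI := hregX' x
    rcases Nat.lt_or_ge μ μ' with hlt | hge
    · exact hinv'.2 x μ' hlt h2 h3
    · have hμ' : μ' = μ := by omega
      subst hμ'
      by_contra hD
      rw [not_lt] at hD
      have hx : x ∈ (companion ([] : List X'.IdealSheafData) D' J' N μ').support :=
        (mem_support_companion_iff [] D' J' hμ hμN).mpr ⟨h3, hD⟩
      have heq := idealOrder_companion_eq_of_mem_support [] hμ hμN hinv' hx
      have hlt := hO' x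
      rw [hO'eq] at hlt
      rw [show (companion ([] : List X'.IdealSheafData) D' J' N μ').ideal = J' ^ (N - μ') ⊔ D' ^ μ' from rfl] at heq
      rw [heq] at hlt
      exact lt_irrefl _ hlt

end Descent

end DepthCascade

end Summit.ResolutionOfSingularities.ResolutionOfSingularities.Theorems

end
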